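import Summits.Ventures.Crystal3D.Theorems.StickyWulffConstantPolycrystalWulffBoundClassRows

/-!
# `PolycrystalWulffBound`, line `PolyDensity`: rows for an AGGREGATED remainder class (all `m ≥ 4`)

Route `StickyWulffConstant` of the venture `Summits/Ventures/Crystal3D`, crux `PolycrystalWulffBound`
(item `stmt-Ventures-19482`), second prover lane (poly-p2, gen 4).  The middle band for an arbitrary number
`m ≥ 4` of lattice classes is attacked by ONE linear programme in the three largest classes and the
aggregated remainder `R` (memo `poly-p2/MIDDLE-BAND-g4.md` §11).  The remainder needs three kinds of rows,
typed here for a general labelling `cls : Fin n → β`: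

* `classSingles_sum_row` — summing the single-class block rows over a set `T` of classes:
  `3·Kq^{1/3}·Σ_{i∈T} |E_i|^{2/3} ≤ Σ_{i∈T} F i + ρq·Σ_{i∈T} Σ_{j≠i} Acl i j` (bodies `KB i ⊆ KC i`);
* the two concavity minorants for `Σ_{i∈T} |E_i|^{2/3}`: `rpow_sum_le_sum_rpow_twoThirds`
  (`(Σ v_i)^{2/3} ≤ Σ v_i^{2/3}`) and `sum_mul_rpow_le_sum_rpow_twoThirds` (`(Σ v_i)·c^{-1/3} ≤ Σ v_i^{2/3}`
  when every `0 ≤ v_i ≤ c`; no sign condition on `c` is needed) — the remainder classes are each at most the third largest class;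
* the inscribed-ball body for blocks containing remainder classes: `toReal_volume_closedBall_sqrt_three`
  (`|B̄(0,√3)| = 4√3·π ≥ 21.765`), to feed `classBlock_row` with `KB = B̄(0,√3)`, cut coefficient `√3`.
WHAT THIS IS NOT: the aggregated certificate itself (next gen); F-C1 not moved.
-/

noncomputable section

namespace Summit.Ventures.Crystal3D.Theorems

open MeasureTheory Set Metric
open scoped RealInnerProductSpace ENNReal Pointwise
open Summit.Ventures.Crystal3D.Cruxes.TextureLiminf.TexShadow
open Literature.Analysis.Convexity
open Literature.MathematicalPhysics.StatisticalMechanics (perimeter HasFinitePerimeter)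

variable {n : ℕ} {β : Type} [DecidableEq β]

/-- Subadditivity of `x ↦ x^{2/3}` over a finite sum of non-negative reals. -/
theorem rpow_sum_le_sum_rpow_twoThirds {ι : Type*} (s : Finset ι) (v : ι → ℝ) (hv : ∀ i ∈ s, 0 ≤ v i) :
    (∑ i ∈ s, v i) ^ ((2 : ℝ) / 3) ≤ ∑ i ∈ s, v i ^ ((2 : ℝ) / 3) := by
  classical
  induction s using Finset.induction_on with
  | empty => simp
  | @insert a s ha ih =>
    rw [Finset.sum_insert ha, Finset.sum_insert ha]
    have hva : 0 ≤ v a := hv a (Finset.mem_insert_self a s)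
    have hs : ∀ i ∈ s, 0 ≤ v i := fun i hi => hv i (Finset.mem_insert_of_mem hi)
    exact le_trans (Real.rpow_add_le_add_rpow hva (Finset.sum_nonneg hs) (by norm_num) (by norm_num))
      (by linarith [ih hs])

/-- Linear minorant: if `0 ≤ v_i ≤ c` then `(Σ v_i)·c^{-1/3} ≤ Σ v_i^{2/3}` (each `v_i^{2/3} = v_i·v_i^{-1/3}
≥ v_i·c^{-1/3}`); used with `c` = the third largest class volume (or a box upper bound for it). -/
theorem sum_mul_rpow_le_sum_rpow_twoThirds {ι : Type*} (s : Finset ι) (v : ι → ℝ) {c : ℝ}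
    (hv : ∀ i ∈ s, 0 ≤ v i) (hvc : ∀ i ∈ s, v i ≤ c) :
    (∑ i ∈ s, v i) * c ^ (-(1 : ℝ) / 3) ≤ ∑ i ∈ s, v i ^ ((2 : ℝ) / 3) := by
  rw [Finset.sum_mul]
  refine Finset.sum_le_sum fun i hi => ?_
  rcases (hv i hi).eq_or_lt with h | h
  · rw [← h]; simp [Real.zero_rpow]
  · have h1 : c ^ (-(1 : ℝ) / 3) ≤ v i ^ (-(1 : ℝ) / 3) :=
      Real.rpow_le_rpow_of_nonpos h (hvc i hi) (by norm_num)
    calc v i * c ^ (-(1 : ℝ) / 3) ≤ v i * v i ^ (-(1 : ℝ) / 3) := mul_le_mul_of_nonneg_left h1 h.le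
      _ = v i ^ ((2 : ℝ) / 3) := by
        rw [show ((2 : ℝ) / 3) = 1 + (-(1 : ℝ) / 3) by norm_num, Real.rpow_add h, Real.rpow_one]

/-- The inscribed ball of every class body: `|B̄(0,√3)| = 4·√3·π`. -/
theorem toReal_volume_closedBall_sqrt_three :
    (volume (closedBall (0 : E3) (Real.sqrt 3))).toReal = 4 * Real.sqrt 3 * Real.pi := by
  rw [EuclideanSpace.volume_closedBall_fin_three, ENNReal.toReal_mul,
    ENNReal.toReal_pow, ENNReal.toReal_ofReal (Real.sqrt_nonneg 3), ENNReal.toReal_ofReal (by positivity)]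
  have h3 : Real.sqrt 3 ^ 3 = 3 * Real.sqrt 3 := by
    rw [pow_succ, Real.sq_sqrt (by norm_num : (0 : ℝ) ≤ 3)]
  rw [h3]; ring

/-- Numerical form: `21.765 ≤ |B̄(0,√3)|`. -/
theorem volume_closedBall_sqrt_three_ge : (21.765 : ℝ) ≤ (volume (closedBall (0 : E3) (Real.sqrt 3))).toReal := by
  rw [toReal_volume_closedBall_sqrt_three]
  have hpi : (3.141592 : ℝ) < Real.pi := Real.pi_gt_d6
  have hs : (1.7320508 : ℝ) ≤ Real.sqrt 3 := by
    rw [show (1.7320508 : ℝ) = Real.sqrt (1.7320508 ^ 2) by rw [Real.sqrt_sq (by norm_num)]]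
    exact Real.sqrt_le_sqrt (by norm_num)
  nlinarith [hs, hpi, Real.sqrt_nonneg 3, Real.pi_pos.le]

/-- **Sum of single-class block rows** over a set `T` of classes: with a body `KB i ⊆ KC i` for each class
(`Kq ≤ |KB i|`, `KB i ⊆ B̄(0,ρ)`, `ρ ≤ ρq`),
`3·Kq^{1/3}·Σ_{i∈T} |E_i|^{2/3} ≤ Σ_{i∈T} F i + ρq·Σ_{i∈T} Σ_{j≠i} Acl i j`.  (For the remainder of the
aggregated LP: `KB i = KC i ∩ B̄(0,√(5−ε))`, `Kq = 32 − 8ε³`; the internal remainder interfaces are counted twice.) -/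
theorem classSingles_sum_row [Fintype β] (G : Fin n → Set E3)
    (hfin : ∀ f, HasFinitePerimeter (G f) ∧ volume (G f) < ⊤)
    (hPoly : ∀ f, ∃ (k : ℕ) (H : Fin k → Finset (E3 × ℝ)), G f = ⋃ i, polytope (H i))
    (hdisjG : ∀ f g, f ≠ g → Disjoint (G f) (G g)) (cls : Fin n → β) (KC : β → Set E3)
    (hKc : ∀ i, IsCompact (KC i)) (hKv : ∀ i, Convex ℝ (KC i)) (hK0 : ∀ i, (0 : E3) ∈ KC i)
    (hKs : ∀ i, -KC i = KC i) (T : Finset β) (KB : β → Set E3) (hBc : ∀ i, IsCompact (KB i))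
    (hBv : ∀ i, Convex ℝ (KB i)) (hB0 : ∀ i, (0 : E3) ∈ KB i) (hBs : ∀ i, -KB i = KB i) {ρ ρq Kq : ℝ}
    (hρ : 0 < ρ) (hρq : ρ ≤ ρq) (hBR : ∀ i, KB i ⊆ closedBall (0 : E3) ρ) (hKq0 : 0 ≤ Kq)
    (hKq : ∀ i ∈ T, Kq ≤ (volume (KB i)).toReal) (hsub : ∀ i ∈ T, KB i ⊆ KC i) :
    3 * Kq ^ ((1 : ℝ) / 3) * ∑ i ∈ T,
        (volume (⋃ f ∈ Finset.univ.filter (fun f => cls f = i), G f)).toReal ^ ((2 : ℝ) / 3) ≤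
      (∑ i ∈ T, ∑ f ∈ Finset.univ.filter (fun f => cls f = i),
        (per (KC (cls f)) (G f) - ∑ g, (if f = g then 0 else
          (per (KC (cls f)) (G f) + per (KC (cls f)) (G g) - per (KC (cls f)) (G f ∪ G g)) / 2))) +
      ρq * ∑ i ∈ T, ∑ j ∈ Finset.univ \ {i}, ∑ f ∈ Finset.univ.filter (fun f => cls f = i),
        ∑ g ∈ Finset.univ.filter (fun g => cls g = j),
          (per (closedBall (0 : E3) 1) (G f) + per (closedBall (0 : E3) 1) (G g) -
            per (closedBall (0 : E3) 1) (G f ∪ G g)) / 2 := by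
  classical
  rw [Finset.mul_sum, Finset.mul_sum, ← Finset.sum_add_distrib]
  refine Finset.sum_le_sum fun i hi => ?_
  have h := classBlock_row G hfin hPoly hdisjG cls KC hKc hKv hK0 hKs {i} (KB i) (hBc i) (hBv i) (hB0 i)
    (hBs i) hρ hρq (hBR i) hKq0 (hKq i hi) (fun i' hi' => by rw [Finset.mem_singleton.1 hi']; exact hsub i hi)
  have hset : Finset.univ.filter (fun f => cls f ∈ ({i} : Finset β)) = Finset.univ.filter (fun f => cls f = i) := by
    ext f; simp
  rw [hset, Finset.sum_singleton, Finset.sum_singleton] at h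
  exact h

end Summit.Ventures.Crystal3D.Theorems

end
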